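import Summits.BirchSwinnertonDyer.BirchSwinnertonDyer.Theorems.SignedLowerHalvesSprungLowerDivisibilityAtThreeKatoSporadicLedger
import Literature.NumberTheory.EllipticCurves.IwasawaAlgebraDivisibilityProofs
import HarnessLib

/-!
# Crux `SprungLowerDivisibilityAtThree` (item stmt-BirchSwinnertonDyer-19875), line `chromatic-common-zeros`, skeleton v8:
# the JOINT (two-colour) sporadic ledger behind stub K_spor `stub_katoFineLowerSporadic` — the pair length
# `ℓ_𝔭 Λ/(a, b) = min`, the joint identity `m = k + j`, the swap identity `m♯ + c♭ = m♭ + c♯`, and the door at one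
# prime «`k ≤ x` ⟸ `j ≤ x` ∧ `k ≤ j`» with `k ≤ j ⟺ 2k ≤ m` (STUB-PLAN socket α, on top of w2 g7's one-colour ledger)

Cell `bsd-ssimc` (host), width seat `cruxlead-stmt-BirchSwinnertonDyer-19875-w3` (gen 6) under the 19875 LEAD; `--supports`
stmt-BirchSwinnertonDyer-19875 `--as helper`; theorems only (no `def`, no named fact, no instance); closes NO item. HONEST
FRAMING: this file fixes the CURRENCY of the open stub K_spor (Kato 2004 Conj. 12.10, Eisenstein half, at the sporadic common
zeros of the two chromatic `p`-adic `L`-functions on class X8) — it is NOT progress on its content. K_spor, K1, leaf X8 and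
BSD are NOT proved by anything here.

SOURCE OF THE LANE. `Cruxes/SprungLowerDivisibilityAtThree/STUB-PLAN-stub_katoFineLowerSporadic.md` (stub critic, 2026-08-28)
§3 rank 1 «PLAN α — partner-Poitou–Tate / sporadic LEDGER door» (cards k2-A ≡ k4-B ≡ k6-A; sketches
`StubKatoFineLowerSporadicK4Sketch.lean` H-B1/H-B3/H-B4, k6 H-A2). ONE-COLOUR LEDGER = the sibling file
`…KatoSporadicLedger.lean` (w2 g7, p648387): `SharpFlatColemanKatoData.lengthAt_quotient_span_eq_zeta_add_range` (`m^• = k + c^•`),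
`…lengthAt_quotient_zeta_le_lengthAt_quotient_span` (`k ≤ m^•`), the simple-zero door — USED here, not restated. Notation at a
height-one prime `𝔭` of `Λ = ℤ_p⟦T⟧`, for the JOINT ♯/♭ Coleman–Kato package (`Cs`, `Cf` on ONE pinned `I = 𝐇¹_Γ(T_pW)`,
`Cs.Z = Cf.Z`, the Literature fact `Sprung2012.thm714seq_sharpFlatColemanKato_zetaJoint`): `k := ℓ_𝔭(I.H ⧸ Z)` (Kato's ZETA
INDEX), `c^• := ℓ_𝔭(Λ ⧸ range C•.colMap)` (the COLEMAN CONTENT / local index of colour `•`), `j := min(c♯, c♭)` (the LOCAL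
INDEX), `m^• := ℓ_𝔭 Λ/(G^•)` for the Néron-normalised `G^• = ϖ·L^•`, `m := min(m♯, m♭)` (the COMMON-ZERO MULTIPLICITY),
`x := ℓ_𝔭 Y.X` (the FINE MASS). The stub K_spor at `𝔭` reads `k ≤ x`.

WHAT IS PROVED:
* §1 (pure algebra, any UFD): at a height-one prime, `ℓ_𝔭 R/(a, b) = min(ℓ_𝔭 R/(a), ℓ_𝔭 R/(b))`
  (`lengthAt_quotient_span_pair_eq_min`; card k4 H-B1) — so `m = ℓ_𝔭 Λ/(G♯, G♭)` IS the multiplicity of the common zero.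
* §2 on top of the one-colour identity: `c^• ≤ m^•`, `m^• = 0 ⟺ k = 0 ∧ c^• = 0`; for the JOINT package
  `m = k + j` (`min_lengthAt_quotient_span_eq_zeta_add_min_coker`; card k6 Plan A's ledger) and `m♯ + c♭ = m♭ + c♯`
  (`lengthAt_quotient_span_add_coker_eq_swap`: the two colours' orders differ exactly by their Coleman contents).
* §3 THE LEDGER DOOR at one prime: `j ≤ x` (the COKERNEL BOUND «F-α», DISPLAYED as a hypothesis in package currency) and
  `k ≤ j` give `k ≤ x` (`katoFineLowerAt_of_cokerBound_of_zeta_le_localIndex`); and `k ≤ j ⟺ 2k ≤ m`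
  (`zeta_le_localIndex_iff_two_mul_zeta_le_min`: the door's hypothesis is the HALF-CONTENT inequality of cards k2/k4).
* THE TELESCOPE is the sibling file `…KatoSporadicLedgerDoor.lean` (this seat, p648498): the registered stub VERBATIM from
  (hFα) «F-α at every sporadic common zero» and (hres) «the stub on the residue `{j < k}`».

WHAT IS NOT HERE. (i) F-α itself — «`j(𝔭) ≤ x(𝔭)` off the Tate lines»: joint Coleman map `(Col♯, Col♭)` onto off `(T)`
(Sprung 2012 §7.1 with Props. 7.3/7.6; Lei–Sujatha 2021 (SES-KP)), Poitou–Tate `0 → 𝐇¹ → H¹_Iw(ℚ_p, T) → X_{p^∞} → X₀ → 0`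
(Kato (17.13.1)), and `char tors X_{p^∞} = char(X₀)^ι` (Wingberg 1989 Cor. 2.5 / Matar 2020 Thm. 1.1) — a Literature typing
task WITH the `ι` (STUB-PLAN §0bis: the stub's `Y` is `γ`-keyed, so print lands at `ι𝔭`); here a displayed hypothesis
only. (ii) The residue `{k > j}` — every simple sporadic common zero with `(k, j) = (1, 0)` — is Kato's main conjecture (⊆)
at a non-classical specialisation; no engine in print at `(3, a₃ = ±3)`; conjecturally empty (Sprung 2015 Conj. 5.6 /
Kurihara–Pollack Problem 3.2), but class-wide emptiness is item C1 `ChromaticCoprimalityX8`, not this file.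

References: [Kato2004Asterisque] Conj. 12.10 (p. 224), Thm. 12.5/12.6 (p. 222), §17.13 with (17.13.1) (p. 280); [Sprung2012]
Def. 6.1, §7.1 Def. 7.1, Props. 7.3/7.6, Thm. 7.14 (3) (p. 1504), Prop. 7.19 (p. 1505); [LeiSujatha2021] (SES-KP), Prop. 3.1,
Thm. 1.2; [KuriharaPollack2007] Prop. 1.2, Problem 3.2; [Wingberg1989] Cor. 2.5; [Matar2020] Thm. 1.1; [Sprung2015] Conj. 5.6;
[Washington1997] §13.2 (height-one primes of `Λ`, `ord_𝔮`); tree: `…KatoSporadicLedger` (w2 g7, p648387), `…KatoSporadicLedgerDoor`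
(p648498), `…KatoFineSporadic` (`lengthAt_quotient_zeta_eq_zero_of_not_mem`), `…ColourTransfer` (p607724: `eisenstein_iff_fine`,
`lengthAt_quotient_zeta_ne_top`), `SignedLowerHalvesKobayashiMainConjectureSmallImageSignedMuDefect` (bookkeeping
`lengthAt_quotient_eq_of_smul_mem`), `IwasawaAlgebraDivisibilityProofs` (`lengthAt_quotient_span_singleton_pow_mul`).
-/

set_option linter.dupNamespace false
set_option autoImplicit false

noncomputable section

open scoped Classical NumberField MatrixGroups ModularForm

open NumberField IsDedekindDomain CongruenceSubgroup WeierstrassCurve Field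
  Literature.NumberTheory.EllipticCurves Literature.NumberTheory.EllipticCurves.ModularForms
  Literature.NumberTheory.EllipticCurves.ZpExtension Literature.NumberTheory.EllipticCurves.Sprung2017
  Literature.NumberTheory.EllipticCurves.Sprung2012 Literature.NumberTheory.EllipticCurves.Rank1Residual
  Literature.NumberTheory.EllipticCurves.IwasawaAlgebra Literature.NumberTheory.EllipticCurves.Kato2004
  Literature.NumberTheory.EllipticCurves.Module
  Summit.BirchSwinnertonDyer.BirchSwinnertonDyer.Theorems
  Summit.BirchSwinnertonDyer.BirchSwinnertonDyer.Theorems.SmallImageSignedMuDefect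

namespace Summit.BirchSwinnertonDyer.BirchSwinnertonDyer.Theorems.ChromaticCommonZeros

/-! ### §1 Pure algebra: the ideal `(a, b)` at a height-one prime of a UFD -/

section PairMin

variable {R : Type*} [CommRing R] [IsDomain R]

/-- At `𝔭 = (π)`, `π` prime: `ℓ_𝔭 R/(π^α a', π^β b') = α` when `α ≤ β` and `π ∤ a'` — the ideals `(π^α a', π^β b')`
and `(π^α)` agree after localisation at `𝔭` (`a'` becomes a unit). [folklore] [cite: Washington1997, §13.2] -/
theorem lengthAt_quotient_span_pair_eq_of_le {π : R} (hπ : Prime π) (𝔭 : PrimeSpectrum R)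
    (h𝔭 : 𝔭.asIdeal = Ideal.span {π}) {α β : ℕ} (hαβ : α ≤ β) (a' b' : R) (ha' : ¬ π ∣ a') :
    lengthAt R (R ⧸ Ideal.span ({π ^ α * a', π ^ β * b'} : Set R)) 𝔭 = α := by
  have hs : a' ∉ 𝔭.asIdeal := by rwa [h𝔭, Ideal.mem_span_singleton]
  have hle : Ideal.span ({π ^ α * a', π ^ β * b'} : Set R) ≤ Ideal.span {π ^ α} := by
    rw [Ideal.span_le]
    rintro x hx
    rcases hx with rfl | rfl
    · exact Ideal.mem_span_singleton.mpr (dvd_mul_right _ _)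
    · exact Ideal.mem_span_singleton.mpr ((pow_dvd_pow π hαβ).mul_right b')
  have key : lengthAt R (R ⧸ Ideal.span ({π ^ α * a', π ^ β * b'} : Set R)) 𝔭 =
      lengthAt R (R ⧸ Ideal.span {π ^ α}) 𝔭 := by
    refine lengthAt_quotient_eq_of_smul_mem _ _ 𝔭 hs ?_ ?_
    · intro x hx
      obtain ⟨r, rfl⟩ := Ideal.mem_span_singleton'.mp hx
      rw [smul_eq_mul, ← mul_assoc, mul_comm a' r, mul_assoc, mul_comm a' (π ^ α)]
      exact Ideal.mul_mem_left _ r (Ideal.subset_span (by simp))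
    · intro x hx
      rw [smul_eq_mul]
      exact Ideal.mul_mem_left _ a' (hle hx)
  have hone : ¬ π ∣ (1 : R) := fun h => hπ.not_unit (isUnit_of_dvd_one h)
  have h1 := lengthAt_quotient_span_singleton_pow_mul hπ α hone 𝔭 h𝔭
  rw [mul_one] at h1
  rw [key, h1]

variable [UniqueFactorizationMonoid R]

/-- **`ℓ_𝔭 R/(a, b) = min(ℓ_𝔭 R/(a), ℓ_𝔭 R/(b))` at a height-one prime of a UFD** (`a, b ≠ 0`): `𝔭 = (π)`
is principal with a prime generator, `R_𝔭` is a DVR, and `(a, b)R_𝔭 = 𝔭^{min(ord_π a, ord_π b)}`. For `Λ = ℤ_p⟦T⟧` and the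
two Néron-normalised chromatic `L`-functions this says: the MULTIPLICITY `ℓ_𝔭 Λ/(G♯, G♭)` of a common zero is
`min(ord_𝔭 G♯, ord_𝔭 G♭)` (card k4 H-B1). [folklore] [cite: Washington1997, §13.2] -/
theorem lengthAt_quotient_span_pair_eq_min (a b : R) (ha : a ≠ 0) (hb : b ≠ 0)
    (𝔭 : PrimeSpectrum R) (h𝔭 : 𝔭.asIdeal.height = 1) :
    lengthAt R (R ⧸ Ideal.span ({a, b} : Set R)) 𝔭 =
      min (lengthAt R (R ⧸ Ideal.span {a}) 𝔭) (lengthAt R (R ⧸ Ideal.span {b}) 𝔭) := by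
  have hne : 𝔭.asIdeal ≠ ⊥ := Ideal.ne_bot_of_height_eq_one h𝔭
  obtain ⟨π, hπmem, hπ⟩ := 𝔭.isPrime.exists_mem_prime_of_ne_bot hne
  have h𝔭π : 𝔭.asIdeal = Ideal.span {π} := Ideal.eq_span_singleton_of_height_eq_one h𝔭 hπmem hπ
  obtain ⟨α, a', ha', rfl⟩ := WfDvdMonoid.max_power_factor ha hπ.irreducible
  obtain ⟨β, b', hb', rfl⟩ := WfDvdMonoid.max_power_factor hb hπ.irreducible
  rw [lengthAt_quotient_span_singleton_pow_mul hπ α ha' 𝔭 h𝔭π,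
    lengthAt_quotient_span_singleton_pow_mul hπ β hb' 𝔭 h𝔭π]
  rcases le_total α β with hαβ | hβα
  · rw [lengthAt_quotient_span_pair_eq_of_le hπ 𝔭 h𝔭π hαβ a' b' ha', min_eq_left (Nat.cast_le.mpr hαβ)]
  · rw [Set.pair_comm, lengthAt_quotient_span_pair_eq_of_le hπ 𝔭 h𝔭π hβα b' a' hb',
      min_eq_right (Nat.cast_le.mpr hβα)]

/-- The same with the ideal written as a sum: `ℓ_𝔭 R/((a) + (b)) = min(ℓ_𝔭 R/(a), ℓ_𝔭 R/(b))`. [folklore] -/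
theorem lengthAt_quotient_span_sup_span_eq_min (a b : R) (ha : a ≠ 0) (hb : b ≠ 0)
    (𝔭 : PrimeSpectrum R) (h𝔭 : 𝔭.asIdeal.height = 1) :
    lengthAt R (R ⧸ (Ideal.span {a} ⊔ Ideal.span {b})) 𝔭 =
      min (lengthAt R (R ⧸ Ideal.span {a}) 𝔭) (lengthAt R (R ⧸ Ideal.span {b}) 𝔭) := by
  rw [← lengthAt_quotient_span_pair_eq_min a b ha hb 𝔭 h𝔭, ← Ideal.span_insert]

end PairMin

/-! ### §2 On top of the one-colour identity `m^• = k + c^•` (w2 g7): `c^• ≤ m^•`, `m^• = 0 ⟺ …`, the JOINT ledger -/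

section Package

variable (W : WeierstrassCurve ℚ) [W.IsElliptic] (p : ℕ) [Fact p.Prime]
  [ContinuousSMul ℤ_[p] (W.tateModule p)] [Module.Free ℤ_[p] (W.tateModule p)]
  [Module.Finite ℤ_[p] (W.tateModule p)]
  {N : ℕ} {f : CuspForm (Gamma0 N) 2} {ϖ : ℚ} {κ : ZpExtension ℚ p} {γ : absoluteGaloisGroup ℚ}
  {E : Type} [Field E] [Algebra ℚ E] {ι : AlgebraicClosure ℚ →ₐ[ℚ] AlgebraicClosure E} {ap : ℤ}
  {g : absoluteGaloisGroup E} {c : ℕ → localPoints W E} {I : IwasawaH1Data W p κ γ}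

/-- **`c^• ≤ m^•`: the Coleman content of colour `•` at `𝔭` is at most the order of `G^•`**:
`ℓ_𝔭(Λ ⧸ range colMap) ≤ ℓ_𝔭 Λ/(G₁)`. [cite: Sprung2012, Def. 6.1, Thm. 7.14 (3)] -/
theorem _root_.Literature.NumberTheory.EllipticCurves.Sprung2012.SharpFlatColemanKatoData.lengthAt_coker_le_lengthAt_quotient_span
    {col : Chroma} (C : SharpFlatColemanKatoData W p f ϖ κ γ ι ap g c col I)
    (hirr : W.HasIrreducibleModPGaloisRep p) {Lsharp Lflat G₁ : IwasawaAlgebra p}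
    (hSP : IsSprungPair f p ap Lsharp Lflat) (hcol : chromaticL col Lsharp Lflat ≠ 0)
    (hG₁ : iwasawaToPowerSeries p G₁ =
      PowerSeries.C ((ϖ : ℚ) : ℚ_[p]) * iwasawaToPowerSeries p (chromaticL col Lsharp Lflat))
    (𝔭 : PrimeSpectrum (IwasawaAlgebra p)) (h𝔭 : 𝔭.asIdeal.height = 1) :
    Module.lengthAt (IwasawaAlgebra p) (IwasawaAlgebra p ⧸ LinearMap.range C.colMap) 𝔭 ≤
      Module.lengthAt (IwasawaAlgebra p) (IwasawaAlgebra p ⧸ Ideal.span {G₁}) 𝔭 := by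
  rw [C.lengthAt_quotient_span_eq_zeta_add_range W p hirr hSP hcol hG₁ 𝔭 h𝔭]
  exact le_add_self

/-- **`m^• = 0 ⟺ k = 0 ∧ c^• = 0`**: the normalised `L`-function of a non-vanishing colour avoids `𝔭` iff both Kato's
zeta index and that colour's Coleman content vanish at `𝔭` (card k6 dictionary «`m = 0 ⟺ k = 0`», one-colour half).
[cite: Sprung2012, Def. 6.1, Thm. 7.14 (3)] [cite: Kato2004Asterisque, Thm. 12.6 (p. 222)] -/
theorem _root_.Literature.NumberTheory.EllipticCurves.Sprung2012.SharpFlatColemanKatoData.lengthAt_quotient_span_eq_zero_iff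
    {col : Chroma} (C : SharpFlatColemanKatoData W p f ϖ κ γ ι ap g c col I)
    (hirr : W.HasIrreducibleModPGaloisRep p) {Lsharp Lflat G₁ : IwasawaAlgebra p}
    (hSP : IsSprungPair f p ap Lsharp Lflat) (hcol : chromaticL col Lsharp Lflat ≠ 0)
    (hG₁ : iwasawaToPowerSeries p G₁ =
      PowerSeries.C ((ϖ : ℚ) : ℚ_[p]) * iwasawaToPowerSeries p (chromaticL col Lsharp Lflat))
    (𝔭 : PrimeSpectrum (IwasawaAlgebra p)) (h𝔭 : 𝔭.asIdeal.height = 1) :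
    Module.lengthAt (IwasawaAlgebra p) (IwasawaAlgebra p ⧸ Ideal.span {G₁}) 𝔭 = 0 ↔
      Module.lengthAt (IwasawaAlgebra p) (I.H ⧸ C.Z) 𝔭 = 0 ∧
        Module.lengthAt (IwasawaAlgebra p) (IwasawaAlgebra p ⧸ LinearMap.range C.colMap) 𝔭 = 0 := by
  rw [C.lengthAt_quotient_span_eq_zeta_add_range W p hirr hSP hcol hG₁ 𝔭 h𝔭]
  constructor
  · intro h
    exact ⟨nonpos_iff_eq_zero.mp (le_self_add.trans h.le), nonpos_iff_eq_zero.mp (le_add_self.trans h.le)⟩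
  · rintro ⟨h1, h2⟩
    rw [h1, h2, zero_add]

/-- **The joint ledger `m = k + j`.** For the JOINT ♯/♭ package (`Cs`, `Cf` on one `𝐇¹` with the SAME zeta line
`Cs.Z = Cf.Z`), both colours non-zero with normalised `Gs, Gf`, at any height-one `𝔭`:
`min(ℓ_𝔭 Λ/(Gs), ℓ_𝔭 Λ/(Gf)) = ℓ_𝔭(𝐇¹/Z) + min(ℓ_𝔭 Λ/range Col♯, ℓ_𝔭 Λ/range Col♭)` — the common-zero multiplicity is the
zeta index plus the local index `j` (card k6 Plan A). [cite: Sprung2012, Def. 6.1, §7.1, Thm. 7.14 (3)]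
[cite: Kato2004Asterisque, Thm. 12.6 (p. 222), §17.13 (p. 280)] -/
theorem min_lengthAt_quotient_span_eq_zeta_add_min_coker
    (Cs : SharpFlatColemanKatoData W p f ϖ κ γ ι ap g c Chroma.sharp I)
    (Cf : SharpFlatColemanKatoData W p f ϖ κ γ ι ap g c Chroma.flat I) (hZ : Cs.Z = Cf.Z)
    (hirr : W.HasIrreducibleModPGaloisRep p) {Lsharp Lflat Gs Gf : IwasawaAlgebra p}
    (hSP : IsSprungPair f p ap Lsharp Lflat) (hs : chromaticL Chroma.sharp Lsharp Lflat ≠ 0)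
    (hf : chromaticL Chroma.flat Lsharp Lflat ≠ 0)
    (hGs : iwasawaToPowerSeries p Gs =
      PowerSeries.C ((ϖ : ℚ) : ℚ_[p]) * iwasawaToPowerSeries p (chromaticL Chroma.sharp Lsharp Lflat))
    (hGf : iwasawaToPowerSeries p Gf =
      PowerSeries.C ((ϖ : ℚ) : ℚ_[p]) * iwasawaToPowerSeries p (chromaticL Chroma.flat Lsharp Lflat))
    (𝔭 : PrimeSpectrum (IwasawaAlgebra p)) (h𝔭 : 𝔭.asIdeal.height = 1) :
    min (Module.lengthAt (IwasawaAlgebra p) (IwasawaAlgebra p ⧸ Ideal.span {Gs}) 𝔭)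
        (Module.lengthAt (IwasawaAlgebra p) (IwasawaAlgebra p ⧸ Ideal.span {Gf}) 𝔭) =
      Module.lengthAt (IwasawaAlgebra p) (I.H ⧸ Cs.Z) 𝔭 +
        min (Module.lengthAt (IwasawaAlgebra p) (IwasawaAlgebra p ⧸ LinearMap.range Cs.colMap) 𝔭)
          (Module.lengthAt (IwasawaAlgebra p) (IwasawaAlgebra p ⧸ LinearMap.range Cf.colMap) 𝔭) := by
  rw [Cs.lengthAt_quotient_span_eq_zeta_add_range W p hirr hSP hs hGs 𝔭 h𝔭,
    Cf.lengthAt_quotient_span_eq_zeta_add_range W p hirr hSP hf hGf 𝔭 h𝔭, ← hZ, min_add_add_left]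

/-- **The two colours' orders differ exactly by their Coleman contents: `m♯ + c♭ = m♭ + c♯`** (joint package, same
zeta line, both colours non-zero, any height-one `𝔭`). At a prime where one Coleman map is onto (`c^∘ = 0`) the other
colour's order EXCEEDS it by exactly its own Coleman content. [cite: Sprung2012, Def. 6.1, §7.1, Thm. 7.14 (3)] -/
theorem lengthAt_quotient_span_add_coker_eq_swap
    (Cs : SharpFlatColemanKatoData W p f ϖ κ γ ι ap g c Chroma.sharp I)
    (Cf : SharpFlatColemanKatoData W p f ϖ κ γ ι ap g c Chroma.flat I) (hZ : Cs.Z = Cf.Z)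
    (hirr : W.HasIrreducibleModPGaloisRep p) {Lsharp Lflat Gs Gf : IwasawaAlgebra p}
    (hSP : IsSprungPair f p ap Lsharp Lflat) (hs : chromaticL Chroma.sharp Lsharp Lflat ≠ 0)
    (hf : chromaticL Chroma.flat Lsharp Lflat ≠ 0)
    (hGs : iwasawaToPowerSeries p Gs =
      PowerSeries.C ((ϖ : ℚ) : ℚ_[p]) * iwasawaToPowerSeries p (chromaticL Chroma.sharp Lsharp Lflat))
    (hGf : iwasawaToPowerSeries p Gf =
      PowerSeries.C ((ϖ : ℚ) : ℚ_[p]) * iwasawaToPowerSeries p (chromaticL Chroma.flat Lsharp Lflat))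
    (𝔭 : PrimeSpectrum (IwasawaAlgebra p)) (h𝔭 : 𝔭.asIdeal.height = 1) :
    Module.lengthAt (IwasawaAlgebra p) (IwasawaAlgebra p ⧸ Ideal.span {Gs}) 𝔭 +
        Module.lengthAt (IwasawaAlgebra p) (IwasawaAlgebra p ⧸ LinearMap.range Cf.colMap) 𝔭 =
      Module.lengthAt (IwasawaAlgebra p) (IwasawaAlgebra p ⧸ Ideal.span {Gf}) 𝔭 +
        Module.lengthAt (IwasawaAlgebra p) (IwasawaAlgebra p ⧸ LinearMap.range Cs.colMap) 𝔭 := by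
  rw [Cs.lengthAt_quotient_span_eq_zeta_add_range W p hirr hSP hs hGs 𝔭 h𝔭,
    Cf.lengthAt_quotient_span_eq_zeta_add_range W p hirr hSP hf hGf 𝔭 h𝔭, ← hZ]
  ring

/-! ### §3 The ledger door at one prime; `k ≤ j ⟺ 2k ≤ m` -/

/-- **THE LEDGER DOOR at one height-one prime** (STUB-PLAN α4; cards k2 `doorT` / k6 `ledger_logic`): Kato's fine lower
bound `ℓ_𝔭(𝐇¹/Z) ≤ ℓ_𝔭 X₀` at `𝔭` follows from (hFα) the COKERNEL BOUND «the local index `j = min(c♯, c♭)` is fine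
mass», DISPLAYED (in print: joint Coleman surjectivity off `(T)` + Poitou–Tate + Wingberg/Matar, WITH an `ι` — see the
module docstring; not typed here), and (hkj) «the zeta index is at most the local index», `k ≤ j`. The complementary
regime `j < k` is the named residue of the stub. Pure transitivity; stated to FIX the currency.
[cite: Kato2004Asterisque, Conj. 12.10 (p. 224), (17.13.1) (p. 280)] [cite: Sprung2012, §7.1, Props. 7.3/7.6] -/
theorem katoFineLowerAt_of_cokerBound_of_zeta_le_localIndex
    (Cs : SharpFlatColemanKatoData W p f ϖ κ γ ι ap g c Chroma.sharp I)
    (Cf : SharpFlatColemanKatoData W p f ϖ κ γ ι ap g c Chroma.flat I)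
    (Y : W.FineSelmerDualData κ γ) (𝔭 : PrimeSpectrum (IwasawaAlgebra p))
    (hFα : min (Module.lengthAt (IwasawaAlgebra p) (IwasawaAlgebra p ⧸ LinearMap.range Cs.colMap) 𝔭)
        (Module.lengthAt (IwasawaAlgebra p) (IwasawaAlgebra p ⧸ LinearMap.range Cf.colMap) 𝔭) ≤
      Module.lengthAt (IwasawaAlgebra p) Y.X 𝔭)
    (hkj : Module.lengthAt (IwasawaAlgebra p) (I.H ⧸ Cs.Z) 𝔭 ≤
      min (Module.lengthAt (IwasawaAlgebra p) (IwasawaAlgebra p ⧸ LinearMap.range Cs.colMap) 𝔭)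
        (Module.lengthAt (IwasawaAlgebra p) (IwasawaAlgebra p ⧸ LinearMap.range Cf.colMap) 𝔭)) :
    Module.lengthAt (IwasawaAlgebra p) (I.H ⧸ Cs.Z) 𝔭 ≤ Module.lengthAt (IwasawaAlgebra p) Y.X 𝔭 :=
  hkj.trans hFα

/-- **`k ≤ j ⟺ 2k ≤ m`** for the joint package at a height-one `𝔭` where both colours are non-zero and normalised
(`m = k + j` by `min_lengthAt_quotient_span_eq_zeta_add_min_coker`; `k < ⊤` at a height-one prime): the door's
hypothesis «zeta index ≤ local index» is the HALF-CONTENT inequality «the zeta index takes at most half of the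
common-zero multiplicity» of cards k2 (`2a ≤ μ`) / k4 (`hhalf`). [cite: Sprung2012, Def. 6.1, Thm. 7.14 (3)]
[cite: Kato2004Asterisque, Thm. 12.6 (p. 222)] -/
theorem zeta_le_localIndex_iff_two_mul_zeta_le_min
    (Cs : SharpFlatColemanKatoData W p f ϖ κ γ ι ap g c Chroma.sharp I)
    (Cf : SharpFlatColemanKatoData W p f ϖ κ γ ι ap g c Chroma.flat I) (hZ : Cs.Z = Cf.Z)
    (hirr : W.HasIrreducibleModPGaloisRep p) {Lsharp Lflat Gs Gf : IwasawaAlgebra p}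
    (hSP : IsSprungPair f p ap Lsharp Lflat) (hs : chromaticL Chroma.sharp Lsharp Lflat ≠ 0)
    (hf : chromaticL Chroma.flat Lsharp Lflat ≠ 0)
    (hGs : iwasawaToPowerSeries p Gs =
      PowerSeries.C ((ϖ : ℚ) : ℚ_[p]) * iwasawaToPowerSeries p (chromaticL Chroma.sharp Lsharp Lflat))
    (hGf : iwasawaToPowerSeries p Gf =
      PowerSeries.C ((ϖ : ℚ) : ℚ_[p]) * iwasawaToPowerSeries p (chromaticL Chroma.flat Lsharp Lflat))
    (hGs0 : Gs ≠ 0) (𝔭 : PrimeSpectrum (IwasawaAlgebra p)) (h𝔭 : 𝔭.asIdeal.height = 1) :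
    Module.lengthAt (IwasawaAlgebra p) (I.H ⧸ Cs.Z) 𝔭 ≤
        min (Module.lengthAt (IwasawaAlgebra p) (IwasawaAlgebra p ⧸ LinearMap.range Cs.colMap) 𝔭)
          (Module.lengthAt (IwasawaAlgebra p) (IwasawaAlgebra p ⧸ LinearMap.range Cf.colMap) 𝔭) ↔
      2 * Module.lengthAt (IwasawaAlgebra p) (I.H ⧸ Cs.Z) 𝔭 ≤
        min (Module.lengthAt (IwasawaAlgebra p) (IwasawaAlgebra p ⧸ Ideal.span {Gs}) 𝔭)
          (Module.lengthAt (IwasawaAlgebra p) (IwasawaAlgebra p ⧸ Ideal.span {Gf}) 𝔭) := by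
  have hk : Module.lengthAt (IwasawaAlgebra p) (I.H ⧸ Cs.Z) 𝔭 ≠ ⊤ :=
    Cs.lengthAt_quotient_zeta_ne_top W p hirr hSP hs hGs hGs0 𝔭 h𝔭
  rw [min_lengthAt_quotient_span_eq_zeta_add_min_coker W p Cs Cf hZ hirr hSP hs hf hGs hGf 𝔭 h𝔭, two_mul]
  exact (WithTop.add_le_add_iff_left hk).symm

end Package

end Summit.BirchSwinnertonDyer.BirchSwinnertonDyer.Theorems.ChromaticCommonZeros

end
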